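import Summits.Ventures.PercRepro.C026PFunTwoLiveL2
import Summits.Ventures.PercRepro.C026PFunCurveL2

/-!
# THEOREM L2 is unconditional when the two live vertices are adjacent (p6, gen 18)

The corner identity `(E00)` — `0 ≤ (P)(0, 0)` at the all-corner cells `liveCells a b` — holds on
every skeleton in which some edge `f` joins the two live vertices `a` and `b`.  This is the
**terminal-edge injection** (mine-3's LEMMA (terminal edge), INBOX 9686 (2)), in the configuration
sum `(P)(0, 0) = ∑_ω [2·(ab|c + ac|b + bc|a − N_AB) + D](ω)` of `pFun_liveCells_eq_sum`
(`C026PFunCorner`), re-cut by the red / blue types of the triple `(c, a, b)`: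

`(P)(0, 0) = 2·#(C,B) + 2·#(C,D) − 2·#(D,A) − 2·#(D,C) + 2·#B + #D`

(`pFun_liveCells_eq_types`; red type = the connection pattern of `c, a, b` in `ω`, blue type = the
pattern in `ωᶜ`; `A = c|a|b`, `B = c` joined to exactly one of `a, b`, `C = ab|c`, `D = cab`).  The
negative terms are paid as follows: `#(D,C) = #(C,D)` and `#(B,C) = #(C,B)` by complementation
(`card_filter_compl_eq`); `#(D,A) + #(D,C) ≤ #D` trivially; and `#(D,A) ≤ #(D,C) + #(B,C)`
(`card_DA_le_of_edge`) by `ω ↦ ω − f`: in a configuration of type `(D,A)` the edge `f` is open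
(otherwise `a ~ b` in blue), closing it keeps `c` joined to `a` or to `b` (the contraction lemma
`conn_update_true_iff`), and the now-blue edge `f` joins `a` and `b` without reaching `c` — so the
image has type `(D,C)` or `(B,C)`, and the map is injective because `f` is open in every source.

Hence THEOREM L2 (`C026PFunTwoLiveL2`, `C026PFunCurveL2`) is unconditional on every skeleton with
adjacent live vertices: `(P) ≥ 0` at every band state of the probe and of the two live vertices
(`pFun_twoCells_nonneg_of_edge_ab`, `pFun_threeCells_nonneg_of_edge_ab`).  In particular
CONJECTURE (P) holds on every complete multigraph with at most two live vertices.  Note that the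
class slack `(CF)` itself is not claimed on this class — only `(E00)`, which has a factor `2` of
room and is all THEOREM L2 needs.
-/

namespace PercRepro

namespace MultiGraph

open Finset

variable {V E : Type*} [Fintype V] [DecidableEq V] [Fintype E] [DecidableEq E]
  {G : MultiGraph V E}

omit [Fintype V] [DecidableEq V] [Fintype E] in
/-- The complement of a configuration with the edge `f` closed is the complement with `f` open. -/
theorem compl_update_false (ω : Config E) (f : E) :
    (Function.update ω f false)ᶜ = Function.update ωᶜ f true := by
  funext e
  rw [Pi.compl_apply, Function.update_apply, Function.update_apply, Pi.compl_apply]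
  split_ifs <;> rfl

omit [Fintype V] [DecidableEq V] [Fintype E] [DecidableEq E] in
/-- An edge joining `a` and `b` is open in every configuration whose complement does not join
`a` and `b`. -/
theorem apply_eq_true_of_not_conn_compl {a b : V} {f : E}
    (hf : (G.fst f = a ∧ G.snd f = b) ∨ (G.fst f = b ∧ G.snd f = a)) {ω : Config E}
    (h : ¬ G.Conn ωᶜ a b) : ω f = true := by
  by_contra hcl
  have hblue : ωᶜ f = true := by
    rw [Pi.compl_apply]
    cases hω : ω f
    · rfl
    · exact absurd hω hcl
  have hadj : G.Conn ωᶜ (G.fst f) (G.snd f) := Conn.of_openAdj (G.openAdj_of_open f hblue)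
  rcases hf with ⟨h1, h2⟩ | ⟨h1, h2⟩
  · rw [h1, h2] at hadj
    exact h hadj
  · rw [h1, h2] at hadj
    exact h hadj.symm

omit [Fintype V] [DecidableEq V] [Fintype E] in
/-- After opening an edge joining `a` and `b`, a vertex `c` is joined to `a` or to `b` only if it was
already joined to `a` or to `b`. -/
theorem conn_or_of_update_true_edge {a b c : V} {f : E}
    (hf : (G.fst f = a ∧ G.snd f = b) ∨ (G.fst f = b ∧ G.snd f = a)) {ω : Config E}
    (h : G.Conn (Function.update ω f true) c a ∨ G.Conn (Function.update ω f true) c b) :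
    G.Conn ω c a ∨ G.Conn ω c b := by
  rw [conn_update_true_iff, conn_update_true_iff] at h
  rcases hf with ⟨h1, h2⟩ | ⟨h1, h2⟩ <;> rw [h1, h2] at h
  · rcases h with (h | ⟨h, _⟩ | ⟨h, _⟩) | (h | ⟨h, _⟩ | ⟨h, _⟩)
    · exact Or.inl h
    · exact Or.inl h
    · exact Or.inr h
    · exact Or.inr h
    · exact Or.inl h
    · exact Or.inr h
  · rcases h with (h | ⟨h, _⟩ | ⟨h, _⟩) | (h | ⟨h, _⟩ | ⟨h, _⟩)
    · exact Or.inl h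
    · exact Or.inr h
    · exact Or.inl h
    · exact Or.inr h
    · exact Or.inr h
    · exact Or.inl h

omit [Fintype V] [DecidableEq V] in
/-- Complementation is a bijection between the configurations satisfying `P` and those satisfying
`Q`, whenever `P ω ↔ Q ωᶜ`. -/
theorem card_filter_compl_eq (P Q : Config E → Prop) [DecidablePred P] [DecidablePred Q]
    (h : ∀ ω, P ω ↔ Q ωᶜ) : (univ.filter P).card = (univ.filter Q).card := by
  refine Finset.card_bij (fun ω _ => ωᶜ) (fun ω hω => ?_)
    (fun ω₁ _ ω₂ _ h12 => compl_injective h12) (fun ω hω => ?_)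
  · simp only [mem_filter, mem_univ, true_and] at hω ⊢
    exact (h ω).1 hω
  · simp only [mem_filter, mem_univ, true_and] at hω
    refine ⟨ωᶜ, ?_, compl_compl ω⟩
    simp only [mem_filter, mem_univ, true_and]
    rw [h, compl_compl]
    exact hω

omit [Fintype V] [DecidableEq V] [Fintype E] [DecidableEq E] in
open Classical in
/-- The C-026 summand at the corner cells, re-cut by the red / blue types of `(c, a, b)`:
`2·[(C,B)] + 2·[(C,D)] − 2·[(D,A)] − 2·[(D,C)] + 2·[B] + [D]`. -/
theorem corner_summand_eq_types (a b c : V) (ω : Config E) :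
    (2 * ((if G.Conn ω a b ∧ ¬ G.Conn ω a c then (1 : ℝ) else 0) +
          (if G.Conn ω c a ∧ ¬ G.Conn ω c b then (1 : ℝ) else 0) +
          (if G.Conn ω c b ∧ ¬ G.Conn ω c a then (1 : ℝ) else 0) -
          (if G.Conn ω a b ∧ ¬ G.Conn ωᶜ c a ∧ ¬ G.Conn ωᶜ c b then (1 : ℝ) else 0)) +
        (if G.Conn ω c a ∧ G.Conn ω c b then (1 : ℝ) else 0)) =
      2 * (if (G.Conn ω a b ∧ ¬ G.Conn ω c a) ∧
              ((G.Conn ωᶜ c a ∧ ¬ G.Conn ωᶜ c b) ∨ (G.Conn ωᶜ c b ∧ ¬ G.Conn ωᶜ c a))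
            then (1 : ℝ) else 0) +
      2 * (if (G.Conn ω a b ∧ ¬ G.Conn ω c a) ∧ (G.Conn ωᶜ c a ∧ G.Conn ωᶜ c b)
            then (1 : ℝ) else 0) -
      2 * (if (G.Conn ω c a ∧ G.Conn ω c b) ∧
              (¬ G.Conn ωᶜ c a ∧ ¬ G.Conn ωᶜ c b ∧ ¬ G.Conn ωᶜ a b) then (1 : ℝ) else 0) -
      2 * (if (G.Conn ω c a ∧ G.Conn ω c b) ∧ (G.Conn ωᶜ a b ∧ ¬ G.Conn ωᶜ c a)
            then (1 : ℝ) else 0) +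
      2 * (if (G.Conn ω c a ∧ ¬ G.Conn ω c b) ∨ (G.Conn ω c b ∧ ¬ G.Conn ω c a)
            then (1 : ℝ) else 0) +
      (if G.Conn ω c a ∧ G.Conn ω c b then (1 : ℝ) else 0) := by
  -- the red pattern
  have r1 : G.Conn ω c a → G.Conn ω c b → G.Conn ω a b := fun h1 h2 => h1.symm.trans h2
  have r2 : G.Conn ω c a → G.Conn ω a b → G.Conn ω c b := fun h1 h2 => h1.trans h2
  have r3 : G.Conn ω c b → G.Conn ω a b → G.Conn ω c a := fun h1 h2 => h1.trans h2.symm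
  have r4 : G.Conn ω a c ↔ G.Conn ω c a := conn_comm
  -- the blue pattern
  have b1 : G.Conn ωᶜ c a → G.Conn ωᶜ c b → G.Conn ωᶜ a b := fun h1 h2 => h1.symm.trans h2
  have b2 : G.Conn ωᶜ c a → G.Conn ωᶜ a b → G.Conn ωᶜ c b := fun h1 h2 => h1.trans h2
  have b3 : G.Conn ωᶜ c b → G.Conn ωᶜ a b → G.Conn ωᶜ c a := fun h1 h2 => h1.trans h2.symm
  by_cases hra : G.Conn ω c a <;> by_cases hrb : G.Conn ω c b <;> by_cases hrab : G.Conn ω a b <;>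
    by_cases hba : G.Conn ωᶜ c a <;> by_cases hbb : G.Conn ωᶜ c b <;>
    by_cases hbab : G.Conn ωᶜ a b <;> simp_all

open Classical in
/-- `(P)` at the corner cells as the (red, blue) type counts:
`(P)(0,0) = 2·#(C,B) + 2·#(C,D) − 2·#(D,A) − 2·#(D,C) + 2·#B + #D`. -/
theorem pFun_liveCells_eq_types (a b c : V) :
    G.pFun c (liveCells a b) (liveCells a b) univ =
      2 * ((univ.filter fun ω : Config E => (G.Conn ω a b ∧ ¬ G.Conn ω c a) ∧
            ((G.Conn ωᶜ c a ∧ ¬ G.Conn ωᶜ c b) ∨ (G.Conn ωᶜ c b ∧ ¬ G.Conn ωᶜ c a))).card : ℝ) +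
      2 * ((univ.filter fun ω : Config E => (G.Conn ω a b ∧ ¬ G.Conn ω c a) ∧
            (G.Conn ωᶜ c a ∧ G.Conn ωᶜ c b)).card : ℝ) -
      2 * ((univ.filter fun ω : Config E => (G.Conn ω c a ∧ G.Conn ω c b) ∧
            (¬ G.Conn ωᶜ c a ∧ ¬ G.Conn ωᶜ c b ∧ ¬ G.Conn ωᶜ a b)).card : ℝ) -
      2 * ((univ.filter fun ω : Config E => (G.Conn ω c a ∧ G.Conn ω c b) ∧
            (G.Conn ωᶜ a b ∧ ¬ G.Conn ωᶜ c a)).card : ℝ) +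
      2 * ((univ.filter fun ω : Config E =>
            (G.Conn ω c a ∧ ¬ G.Conn ω c b) ∨ (G.Conn ω c b ∧ ¬ G.Conn ω c a)).card : ℝ) +
      ((univ.filter fun ω : Config E => G.Conn ω c a ∧ G.Conn ω c b).card : ℝ) := by
  rw [pFun_liveCells_eq_sum]
  simp only [corner_summand_eq_types, Finset.sum_add_distrib, Finset.sum_sub_distrib,
    ← Finset.mul_sum, Finset.sum_boole]

omit [Fintype V] [DecidableEq V] in
open Classical in
/-- **The terminal-edge injection** (mine-3, INBOX 9686 (2)): if the edge `f` joins `a` and `b`,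
closing `f` injects the configurations of type `(D,A)` into those of type `(D,C)` or `(B,C)`. -/
theorem card_DA_le_of_edge (a b c : V) (f : E)
    (hf : (G.fst f = a ∧ G.snd f = b) ∨ (G.fst f = b ∧ G.snd f = a)) :
    (univ.filter fun ω : Config E => (G.Conn ω c a ∧ G.Conn ω c b) ∧
        (¬ G.Conn ωᶜ c a ∧ ¬ G.Conn ωᶜ c b ∧ ¬ G.Conn ωᶜ a b)).card ≤
      (univ.filter fun ω : Config E => (G.Conn ω c a ∧ G.Conn ω c b) ∧
          (G.Conn ωᶜ a b ∧ ¬ G.Conn ωᶜ c a)).card +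
      (univ.filter fun ω : Config E =>
          ((G.Conn ω c a ∧ ¬ G.Conn ω c b) ∨ (G.Conn ω c b ∧ ¬ G.Conn ω c a)) ∧
          (G.Conn ωᶜ a b ∧ ¬ G.Conn ωᶜ c a)).card := by
  refine le_trans (Finset.card_le_card_of_injOn (fun ω => Function.update ω f false) ?_ ?_)
    (Finset.card_union_le _ _)
  · intro ω hω
    simp only [coe_filter, mem_univ, true_and, Set.mem_setOf_eq, mem_coe, mem_filter,
      mem_union] at hω ⊢
    obtain ⟨⟨hca, hcb⟩, hba, hbb, hbab⟩ := hω
    have hopen : ω f = true := apply_eq_true_of_not_conn_compl hf hbab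
    have hrest : Function.update (Function.update ω f false) f true = ω := by
      rw [Function.update_idem]
      exact Function.update_eq_self_iff.2 hopen.symm
    -- red: `c` stays joined to `a` or to `b`
    have hred : G.Conn (Function.update ω f false) c a ∨ G.Conn (Function.update ω f false) c b :=
      conn_or_of_update_true_edge hf (Or.inl (by rw [hrest]; exact hca))
    -- blue: `f` joins `a` and `b`, and `c` stays apart
    have hbab' : G.Conn (Function.update ω f false)ᶜ a b := by
      rw [compl_update_false]
      have hadj : G.Conn (Function.update ωᶜ f true) (G.fst f) (G.snd f) :=
        Conn.of_openAdj (G.openAdj_of_open f (by simp))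
      rcases hf with ⟨h1, h2⟩ | ⟨h1, h2⟩
      · rw [h1, h2] at hadj
        exact hadj
      · rw [h1, h2] at hadj
        exact hadj.symm
    have hba' : ¬ G.Conn (Function.update ω f false)ᶜ c a := by
      rw [compl_update_false]
      intro h
      rcases conn_or_of_update_true_edge hf (Or.inl h) with h' | h'
      · exact hba h'
      · exact hbb h'
    by_cases hca' : G.Conn (Function.update ω f false) c a <;>
      by_cases hcb' : G.Conn (Function.update ω f false) c b
    · exact Or.inl ⟨⟨hca', hcb'⟩, hbab', hba'⟩
    · exact Or.inr ⟨Or.inl ⟨hca', hcb'⟩, hbab', hba'⟩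
    · exact Or.inr ⟨Or.inr ⟨hcb', hca'⟩, hbab', hba'⟩
    · exact absurd hred (by rintro (h | h) <;> contradiction)
  · intro ω₁ h₁ ω₂ h₂ h12
    simp only [coe_filter, mem_univ, true_and, Set.mem_setOf_eq] at h₁ h₂
    have h₁' : ω₁ f = true := apply_eq_true_of_not_conn_compl hf h₁.2.2.2
    have h₂' : ω₂ f = true := apply_eq_true_of_not_conn_compl hf h₂.2.2.2
    have e1 : Function.update (Function.update ω₁ f false) f true = ω₁ := by
      rw [Function.update_idem]
      exact Function.update_eq_self_iff.2 h₁'.symm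
    have e2 : Function.update (Function.update ω₂ f false) f true = ω₂ := by
      rw [Function.update_idem]
      exact Function.update_eq_self_iff.2 h₂'.symm
    rw [← e1, ← e2]
    simp only at h12
    rw [h12]

open Classical in
/-- **`(E00)` on adjacent live vertices**: if some edge joins `a` and `b`, the `k = 2` all-corner
value of `(P)` is nonnegative — the corner identity of THEOREM L2 holds on the skeleton. -/
theorem pFun_liveCells_nonneg_of_edge_ab (a b c : V) (f : E)
    (hf : (G.fst f = a ∧ G.snd f = b) ∨ (G.fst f = b ∧ G.snd f = a)) :
    0 ≤ G.pFun c (liveCells a b) (liveCells a b) univ := by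
  rw [pFun_liveCells_eq_types]
  -- `#(C,D) = #(D,C)` by complementation
  have h1 : (univ.filter fun ω : Config E => (G.Conn ω a b ∧ ¬ G.Conn ω c a) ∧
        (G.Conn ωᶜ c a ∧ G.Conn ωᶜ c b)).card =
      (univ.filter fun ω : Config E => (G.Conn ω c a ∧ G.Conn ω c b) ∧
        (G.Conn ωᶜ a b ∧ ¬ G.Conn ωᶜ c a)).card :=
    card_filter_compl_eq _ _ fun ω => by
      simp only [compl_compl]
      exact and_comm
  -- `#(C,B) = #(B,C)` by complementation
  have h2 : (univ.filter fun ω : Config E => (G.Conn ω a b ∧ ¬ G.Conn ω c a) ∧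
        ((G.Conn ωᶜ c a ∧ ¬ G.Conn ωᶜ c b) ∨ (G.Conn ωᶜ c b ∧ ¬ G.Conn ωᶜ c a))).card =
      (univ.filter fun ω : Config E =>
        ((G.Conn ω c a ∧ ¬ G.Conn ω c b) ∨ (G.Conn ω c b ∧ ¬ G.Conn ω c a)) ∧
        (G.Conn ωᶜ a b ∧ ¬ G.Conn ωᶜ c a)).card :=
    card_filter_compl_eq _ _ fun ω => by
      simp only [compl_compl]
      exact and_comm
  -- `#(D,A) + #(D,C) ≤ #D`
  have h3 : (univ.filter fun ω : Config E => (G.Conn ω c a ∧ G.Conn ω c b) ∧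
        (¬ G.Conn ωᶜ c a ∧ ¬ G.Conn ωᶜ c b ∧ ¬ G.Conn ωᶜ a b)).card +
      (univ.filter fun ω : Config E => (G.Conn ω c a ∧ G.Conn ω c b) ∧
        (G.Conn ωᶜ a b ∧ ¬ G.Conn ωᶜ c a)).card ≤
      (univ.filter fun ω : Config E => G.Conn ω c a ∧ G.Conn ω c b).card := by
    rw [← Finset.card_union_of_disjoint]
    · apply Finset.card_le_card
      intro ω hω
      simp only [mem_union, mem_filter, mem_univ, true_and] at hω ⊢
      rcases hω with h | h
      · exact h.1
      · exact h.1
    · rw [Finset.disjoint_filter]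
      intro ω _ h h'
      exact h.2.2.2 h'.2.1
  -- the terminal-edge injection `#(D,A) ≤ #(D,C) + #(B,C)`
  have h4 := card_DA_le_of_edge a b c f hf
  have h1' : ((univ.filter fun ω : Config E => (G.Conn ω a b ∧ ¬ G.Conn ω c a) ∧
        (G.Conn ωᶜ c a ∧ G.Conn ωᶜ c b)).card : ℝ) =
      ((univ.filter fun ω : Config E => (G.Conn ω c a ∧ G.Conn ω c b) ∧
        (G.Conn ωᶜ a b ∧ ¬ G.Conn ωᶜ c a)).card : ℝ) := by exact_mod_cast h1
  have h2' : ((univ.filter fun ω : Config E => (G.Conn ω a b ∧ ¬ G.Conn ω c a) ∧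
        ((G.Conn ωᶜ c a ∧ ¬ G.Conn ωᶜ c b) ∨ (G.Conn ωᶜ c b ∧ ¬ G.Conn ωᶜ c a))).card : ℝ) =
      ((univ.filter fun ω : Config E =>
        ((G.Conn ω c a ∧ ¬ G.Conn ω c b) ∨ (G.Conn ω c b ∧ ¬ G.Conn ω c a)) ∧
        (G.Conn ωᶜ a b ∧ ¬ G.Conn ωᶜ c a)).card : ℝ) := by exact_mod_cast h2
  have h3' : ((univ.filter fun ω : Config E => (G.Conn ω c a ∧ G.Conn ω c b) ∧
        (¬ G.Conn ωᶜ c a ∧ ¬ G.Conn ωᶜ c b ∧ ¬ G.Conn ωᶜ a b)).card : ℝ) +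
      ((univ.filter fun ω : Config E => (G.Conn ω c a ∧ G.Conn ω c b) ∧
        (G.Conn ωᶜ a b ∧ ¬ G.Conn ωᶜ c a)).card : ℝ) ≤
      ((univ.filter fun ω : Config E => G.Conn ω c a ∧ G.Conn ω c b).card : ℝ) := by
    exact_mod_cast h3
  have h4' : ((univ.filter fun ω : Config E => (G.Conn ω c a ∧ G.Conn ω c b) ∧
        (¬ G.Conn ωᶜ c a ∧ ¬ G.Conn ωᶜ c b ∧ ¬ G.Conn ωᶜ a b)).card : ℝ) ≤
      ((univ.filter fun ω : Config E => (G.Conn ω c a ∧ G.Conn ω c b) ∧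
          (G.Conn ωᶜ a b ∧ ¬ G.Conn ωᶜ c a)).card : ℝ) +
      ((univ.filter fun ω : Config E =>
          ((G.Conn ω c a ∧ ¬ G.Conn ω c b) ∨ (G.Conn ω c b ∧ ¬ G.Conn ω c a)) ∧
          (G.Conn ωᶜ a b ∧ ¬ G.Conn ωᶜ c a)).card : ℝ) := by exact_mod_cast h4
  have h5 : (0 : ℝ) ≤ ((univ.filter fun ω : Config E =>
      (G.Conn ω c a ∧ ¬ G.Conn ω c b) ∨ (G.Conn ω c b ∧ ¬ G.Conn ω c a)).card : ℝ) :=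
    Nat.cast_nonneg _
  have h6 : (0 : ℝ) ≤ ((univ.filter fun ω : Config E =>
      ((G.Conn ω c a ∧ ¬ G.Conn ω c b) ∨ (G.Conn ω c b ∧ ¬ G.Conn ω c a)) ∧
      (G.Conn ωᶜ a b ∧ ¬ G.Conn ωᶜ c a)).card : ℝ) :=
    Nat.cast_nonneg _
  linarith

/-- **THEOREM L2 (bare probe) is unconditional when the live vertices are adjacent**: if some edge
joins `a` and `b`, then `(P) ≥ 0` at every band state of the two live vertices. -/
theorem pFun_twoCells_nonneg_of_edge_ab (a b c : V) (f : E)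
    (hf : (G.fst f = a ∧ G.snd f = b) ∨ (G.fst f = b ∧ G.snd f = a)) {x₁ K₁ x₂ K₂ : ℝ}
    (hx₁ : 0 ≤ x₁ ∧ x₁ ≤ 1) (hx₂ : 0 ≤ x₂ ∧ x₂ ≤ 1) (hK₁ : kMin x₁ ≤ K₁) (hK₂ : kMin x₂ ≤ K₂) :
    0 ≤ G.pFun c (twoCells a b x₁ x₂) (twoCells a b K₁ K₂) univ :=
  pFun_twoCells_nonneg_of_corner a b c hx₁ hx₂ hK₁ hK₂ (pFun_liveCells_nonneg_of_edge_ab a b c f hf)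

/-- **THEOREM L2 (live probe) is unconditional when the live vertices are adjacent**: if some edge
joins `a` and `b`, then `(P) ≥ 0` at every band state of the probe and of the two live vertices. -/
theorem pFun_threeCells_nonneg_of_edge_ab (a b c : V) (f : E)
    (hf : (G.fst f = a ∧ G.snd f = b) ∨ (G.fst f = b ∧ G.snd f = a)) {z κ x₁ K₁ x₂ K₂ : ℝ}
    (hz : 0 ≤ z ∧ z ≤ 1) (hκ : kMin z ≤ κ) (hx₁ : 0 ≤ x₁ ∧ x₁ ≤ 1) (hx₂ : 0 ≤ x₂ ∧ x₂ ≤ 1)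
    (hK₁ : kMin x₁ ≤ K₁) (hK₂ : kMin x₂ ≤ K₂) :
    0 ≤ G.pFun c (threeCells c a b z x₁ x₂) (threeCells c a b κ K₁ K₂) univ :=
  pFun_threeCells_nonneg_of_E00 c a b hz hκ hx₁ hx₂ hK₁ hK₂
    (pFun_liveCells_nonneg_of_edge_ab a b c f hf)

end MultiGraph

end PercRepro
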